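import Summits.NavierStokesRegularity.NavierStokesRegularity.Theorems.LinearLiouvilleSeven.Negative.ParasiticModes
import Summits.NavierStokesRegularity.NavierStokesRegularity.Theorems.LinearLiouvilleSeven.Negative.AffineModes

/-!
# `LinearLiouvilleSeven`: the pressure growth bound of the tempered class is load-bearing (strain modes)

Negative-side support for crux stmt-NavierStokesRegularity-4054 (cdisprove seat). Dropping ONLY the
pressure growth `|q| ≤ K/(−t) + K(1+‖x‖)/√(−t)³` from the seven-family hypothesis (velocity still
tempered; an honest weakening, `sevenTemperedNoPressureBound_of_sevenTempered`) admits the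
time-dependent strain modes `v = (a − t)⁻¹ S x`, `q = −(a − t)⁻² ⟪x, Sx⟫ / 2` (`S` symmetric
traceless, `a ≥ 1`; `strain_clause`), whose pressure grows quadratically; seven of them are
independent modulo slice-constants at `u = 0` (`strainFamily_indep_modSlice`):
`linearLiouvilleSeven_false_without_pressure_bound`. Together with `AffineModes` this is the complete
checked form of the crux docstring's remark "affine modes `M(t)x` are excluded by the pressure growth
and `t → −∞`": both exclusions are needed, each alone fails.

## References

* G. Koch, N. Nadirashvili, G. Seregin, V. Šverák, Acta Math. 203 (2009), §1 (parasitic solutions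
  `b(t)`, `−b′(t)·x`), (1.4), Prop. 4.1, Remark 6.1. [KNSS2009]
* C. R. Doering, J. D. Gibbon, *Applied Analysis of the Navier–Stokes Equations*, CUP 1995, §9.3
  (9.3.2) (the linearised system). [DoeringGibbon1995]
-/

noncomputable section

open Set Function MeasureTheory InnerProductSpace
open scoped Laplacian ContDiff Topology RealInnerProductSpace BigOperators

set_option linter.dupNamespace false

namespace Summit.NavierStokesRegularity.NavierStokesRegularity.Theorems.LinearLiouvilleSeven.Negative

open Literature.Analysis Literature.Analysis.FluidPDE
open Summit.NavierStokesRegularity.NavierStokesRegularity.Theses.SymmetryModuliCount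

section Strain

/-- The seven-family hypothesis with the PRESSURE growth bound dropped; other clauses verbatim. -/
def SevenTemperedNoPressureBound (u : ℝ → E3 → E3) (v : Fin 7 → ℝ → E3 → E3)
    (q : Fin 7 → ℝ → E3 → ℝ) : Prop :=
  ∀ i, (ContDiffOn ℝ (⊤ : ℕ∞) (Function.uncurry (v i)) (Set.Iio 0 ×ˢ Set.univ) ∧
    ContDiffOn ℝ (⊤ : ℕ∞) (Function.uncurry (q i)) (Set.Iio 0 ×ˢ Set.univ) ∧
    (∃ K : ℝ, ∀ t < 0, ∀ x, ‖(v i) t x‖ ≤ K / Real.sqrt (-t) + K * (1 + ‖x‖) / (-t)) ∧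
    (∀ t < 0, VectorCalculus.IsDivFree ((v i) t)) ∧
    (∀ t < 0, ∀ x, timeDeriv (v i) t x + convect (u t) ((v i) t) x + convect ((v i) t) (u t) x =
      Laplacian.laplacian ((v i) t) x - gradient ((q i) t) x))

/-- Dropping the pressure bound is an honest weakening of the hypothesis. -/
theorem sevenTemperedNoPressureBound_of_sevenTempered {u : ℝ → E3 → E3}
    {v : Fin 7 → ℝ → E3 → E3} {q : Fin 7 → ℝ → E3 → ℝ} (h : SevenTempered u v q) :
    SevenTemperedNoPressureBound u v q := fun i => by
  obtain ⟨h1, h2, ⟨K, hK⟩, h4, h5⟩ := h i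
  exact ⟨h1, h2, ⟨K, fun t ht x => (hK t ht x).1⟩, h4, h5⟩

/-- The crux with the pressure growth bound dropped. -/
def LinearLiouvilleSevenWithoutPressureBound : Prop :=
  ∀ C u, InClassA C u → ∀ v q, SevenTemperedNoPressureBound u v q → DependentModSlice v

/-- Strain mode `v(t,x) = (a − t)⁻¹ S x`. -/
def strainV (a : ℝ) (S : E3 →L[ℝ] E3) : ℝ → E3 → E3 := fun t x => (a - t)⁻¹ • S x

/-- Its pressure `q(t,x) = −(a − t)⁻² ⟪x, Sx⟫ / 2` (quadratic growth). -/
def strainQ (a : ℝ) (S : E3 →L[ℝ] E3) : ℝ → E3 → ℝ :=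
  fun t x => -((a - t)⁻¹ ^ 2 / 2 * ⟪x, S x⟫)

/-- Slices of the strain mode are the linear maps `(a−t)⁻¹ S`. -/
theorem strainV_slice (a : ℝ) (S : E3 →L[ℝ] E3) (t : ℝ) :
    strainV a S t = ⇑((a - t)⁻¹ • S) := by
  funext x; simp [strainV]

/-- The quadratic form of a symmetric map has gradient `2Sx`. -/
theorem hasFDerivAt_inner_self_clm (S : E3 →L[ℝ] E3) (hS : ∀ x y, ⟪S x, y⟫ = ⟪x, S y⟫) (x : E3) :
    HasFDerivAt (fun y : E3 => ⟪y, S y⟫) (InnerProductSpace.toDual ℝ E3 ((2 : ℝ) • S x)) x := by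
  have h := (hasFDerivAt_id (𝕜 := ℝ) x).inner ℝ (S.hasFDerivAt (x := x))
  refine h.congr_fderiv ?_
  refine ContinuousLinearMap.ext fun y => ?_
  simp only [InnerProductSpace.toDual_apply_apply, ContinuousLinearMap.comp_apply,
    ContinuousLinearMap.prod_apply, fderivInnerCLM_apply, id_eq, ContinuousLinearMap.id_apply]
  rw [real_inner_smul_left, real_inner_comm (S x) y, hS x y]
  ring

/-- Strain modes (symmetric traceless `S`, `a ≥ 1`) satisfy the no-pressure-bound clause about `u = 0`. -/
theorem strain_clause {a : ℝ} (ha : 1 ≤ a) (S : E3 →L[ℝ] E3) (hS : ∀ x y, ⟪S x, y⟫ = ⟪x, S y⟫)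
    (htr : ∑ i, ⟪EuclideanSpace.single i (1 : ℝ), S (EuclideanSpace.single i 1)⟫ = 0) :
    (ContDiffOn ℝ (⊤ : ℕ∞) (Function.uncurry (strainV a S)) (Set.Iio 0 ×ˢ Set.univ) ∧
    ContDiffOn ℝ (⊤ : ℕ∞) (Function.uncurry (strainQ a S)) (Set.Iio 0 ×ˢ Set.univ) ∧
    (∃ K : ℝ, ∀ t < 0, ∀ x, ‖(strainV a S) t x‖ ≤ K / Real.sqrt (-t) + K * (1 + ‖x‖) / (-t)) ∧
    (∀ t < 0, VectorCalculus.IsDivFree ((strainV a S) t)) ∧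
    (∀ t < 0, ∀ x, timeDeriv (strainV a S) t x + convect ((0 : ℝ → E3 → E3) t) ((strainV a S) t) x +
      convect ((strainV a S) t) ((0 : ℝ → E3 → E3) t) x =
      Laplacian.laplacian ((strainV a S) t) x - gradient ((strainQ a S) t) x)) := by
  have hinv := contDiffOn_inv_sub_fst (a := a) (by linarith)
  refine ⟨?_, ?_, ⟨‖S‖, fun t ht x => ?_⟩, ?_, ?_⟩
  · change ContDiffOn ℝ (⊤ : ℕ∞) (fun p : ℝ × E3 => (a - p.1)⁻¹ • S p.2) (Set.Iio 0 ×ˢ Set.univ)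
    exact hinv.smul (S.contDiff.comp contDiff_snd).contDiffOn
  · change ContDiffOn ℝ (⊤ : ℕ∞) (fun p : ℝ × E3 => -((a - p.1)⁻¹ ^ 2 / 2 * ⟪p.2, S p.2⟫))
      (Set.Iio 0 ×ˢ Set.univ)
    exact (((hinv.pow 2).div_const 2).mul
      (contDiffOn_snd.inner ℝ (S.contDiff.comp contDiff_snd).contDiffOn)).neg
  · have hat : 0 < a - t := by linarith
    have hnt : 0 < -t := by linarith
    show ‖(a - t)⁻¹ • S x‖ ≤ _
    rw [norm_smul, Real.norm_eq_abs, abs_of_pos (inv_pos.2 hat)]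
    have hS0 : 0 ≤ ‖S‖ := norm_nonneg _
    calc (a - t)⁻¹ * ‖S x‖ ≤ (-t)⁻¹ * (‖S‖ * ‖x‖) := by
          apply mul_le_mul (inv_anti₀ hnt (by linarith)) (S.le_opNorm x) (norm_nonneg _)
          positivity
      _ ≤ (-t)⁻¹ * (‖S‖ * (1 + ‖x‖)) := by gcongr; linarith
      _ = ‖S‖ * (1 + ‖x‖) / (-t) := by ring
      _ ≤ ‖S‖ / Real.sqrt (-t) + ‖S‖ * (1 + ‖x‖) / (-t) := le_add_of_nonneg_left (by positivity)
  · intro t _ x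
    show VectorCalculus.divergence (strainV a S t) x = 0
    rw [strainV_slice, divergence_clm]
    simp only [FunLike.coe_smul, Pi.smul_apply, inner_smul_right, ← Finset.mul_sum, htr,
      mul_zero]
  · intro t ht x
    have hat : a - t ≠ 0 := by intro h; linarith
    have e1 : timeDeriv (strainV a S) t x = ((a - t)⁻¹ ^ 2) • S x := by
      simp only [timeDeriv, strainV]
      exact ((hasDerivAt_inv_sub hat).smul_const (S x)).deriv
    have e2 : convect ((0 : ℝ → E3 → E3) t) ((strainV a S) t) x = 0 := by simp [convect]
    have e3 : convect ((strainV a S) t) ((0 : ℝ → E3 → E3) t) x = 0 := by simp [convect]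
    have e4 : Δ ((strainV a S) t) x = 0 := by rw [strainV_slice, laplacian_clm]
    have e5 : gradient ((strainQ a S) t) x = (-((a - t)⁻¹ ^ 2)) • S x := by
      have hq := ((hasFDerivAt_inner_self_clm S hS x).const_mul ((a - t)⁻¹ ^ 2 / 2)).neg
      have hg : HasGradientAt (strainQ a S t) ((-((a - t)⁻¹ ^ 2)) • S x) x := by
        rw [hasGradientAt_iff_hasFDerivAt]
        have e : -(((a - t)⁻¹ ^ 2 / 2) • InnerProductSpace.toDual ℝ E3 ((2 : ℝ) • S x)) =
            InnerProductSpace.toDual ℝ E3 ((-((a - t)⁻¹ ^ 2)) • S x) := by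
          rw [← (InnerProductSpace.toDual ℝ E3).map_smul, smul_smul, ← map_neg, ← neg_smul]
          congr 2
          ring
        rw [← e]
        exact hq
      exact hg.gradient
    rw [e1, e2, e3, e4, e5, add_zero, add_zero, neg_smul, zero_sub, neg_neg]

/-- Symmetric elementary maps `x_b e_a + x_a e_b` … -/
def symMap (a b : Fin 3) : E3 →L[ℝ] E3 := eMap a b + eMap b a

/-- … and traceless diagonal maps `x_a e_a − x_b e_b`. -/
def diagMap (a b : Fin 3) : E3 →L[ℝ] E3 := eMap a a - eMap b b

/-- `symMap` is symmetric. -/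
theorem symMap_symm (a b : Fin 3) (x y : E3) : ⟪symMap a b x, y⟫ = ⟪x, symMap a b y⟫ := by
  simp [symMap, eMap_apply, inner_add_left, inner_add_right, real_inner_smul_left,
    real_inner_smul_right, EuclideanSpace.inner_single_left, EuclideanSpace.inner_single_right]
  ring

/-- `diagMap` is symmetric. -/
theorem diagMap_symm (a b : Fin 3) (x y : E3) : ⟪diagMap a b x, y⟫ = ⟪x, diagMap a b y⟫ := by
  simp [diagMap, eMap_apply, inner_sub_left, inner_sub_right, real_inner_smul_left,
    real_inner_smul_right, EuclideanSpace.inner_single_left, EuclideanSpace.inner_single_right]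
  ring

/-- The seven strain generators. -/
def strainS : Fin 7 → (E3 →L[ℝ] E3) :=
  ![symMap 0 1, symMap 0 2, symMap 1 2, diagMap 0 1, diagMap 1 2, symMap 0 1, symMap 0 2]

/-- Their time shifts. -/
def strainShift : Fin 7 → ℝ := ![1, 1, 1, 1, 1, 2, 2]

/-- The seven generators are symmetric. -/
theorem strainS_symm (i : Fin 7) (x y : E3) : ⟪strainS i x, y⟫ = ⟪x, strainS i y⟫ := by
  fin_cases i <;> simp [strainS, symMap_symm, diagMap_symm]

/-- The seven generators are traceless. -/
theorem strainS_traceless (i : Fin 7) :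
    ∑ j, ⟪EuclideanSpace.single j (1 : ℝ), strainS i (EuclideanSpace.single j 1)⟫ = 0 := by
  fin_cases i <;>
    simp [strainS, symMap, diagMap, Fin.sum_univ_three, eMap_apply, EuclideanSpace.inner_single_left]

/-- All shifts are `≥ 1`. -/
theorem one_le_strainShift (i : Fin 7) : 1 ≤ strainShift i := by
  fin_cases i <;> simp [strainShift]

/-- The seven strain modes and their pressures. -/
def strainFamilyV (i : Fin 7) : ℝ → E3 → E3 := strainV (strainShift i) (strainS i)
/-- Pressures of the strain family. -/
def strainFamilyQ (i : Fin 7) : ℝ → E3 → ℝ := strainQ (strainShift i) (strainS i)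

/-- Unfolding the strain family. -/
theorem strainFamilyV_apply (i : Fin 7) (t : ℝ) (x : E3) :
    strainFamilyV i t x = (strainShift i - t)⁻¹ • strainS i x := rfl

/-- The strain family satisfies the no-pressure-bound hypothesis about `u = 0`. -/
theorem strainFamily_clause : SevenTemperedNoPressureBound 0 strainFamilyV strainFamilyQ := fun i =>
  strain_clause (one_le_strainShift i) (strainS i) (strainS_symm i) (strainS_traceless i)

/-- The strain family is independent modulo slice-wise constants (two time samples). -/
theorem strainFamily_indep_modSlice (c : Fin 7 → ℝ)
    (h : ∀ t < 0, ∃ b : E3, ∀ x : E3, ∑ i, c i • strainFamilyV i t x = b) : c = 0 := by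
  obtain ⟨b1, hb1⟩ := h (-1) (by norm_num)
  obtain ⟨b2, hb2⟩ := h (-2) (by norm_num)
  have hb10 : b1 = 0 := by rw [← hb1 0]; simp [strainFamilyV_apply]
  have hb20 : b2 = 0 := by rw [← hb2 0]; simp [strainFamilyV_apply]
  subst hb10; subst hb20
  have k1 := congrArg (fun w : E3 => ⟪EuclideanSpace.single (1 : Fin 3) (1 : ℝ), w⟫) (hb1 (EuclideanSpace.single 0 1))
  have k2 := congrArg (fun w : E3 => ⟪EuclideanSpace.single (2 : Fin 3) (1 : ℝ), w⟫) (hb1 (EuclideanSpace.single 0 1))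
  have k3 := congrArg (fun w : E3 => ⟪EuclideanSpace.single (0 : Fin 3) (1 : ℝ), w⟫) (hb1 (EuclideanSpace.single 0 1))
  have k4 := congrArg (fun w : E3 => ⟪EuclideanSpace.single (2 : Fin 3) (1 : ℝ), w⟫) (hb1 (EuclideanSpace.single 1 1))
  have k5 := congrArg (fun w : E3 => ⟪EuclideanSpace.single (2 : Fin 3) (1 : ℝ), w⟫) (hb1 (EuclideanSpace.single 2 1))
  have k6 := congrArg (fun w : E3 => ⟪EuclideanSpace.single (1 : Fin 3) (1 : ℝ), w⟫) (hb2 (EuclideanSpace.single 0 1))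
  have k7 := congrArg (fun w : E3 => ⟪EuclideanSpace.single (2 : Fin 3) (1 : ℝ), w⟫) (hb2 (EuclideanSpace.single 0 1))
  simp [Fin.sum_univ_seven, strainFamilyV_apply, strainS, strainShift, symMap, diagMap, eMap_apply,
    inner_add_right, inner_smul_right, EuclideanSpace.inner_single_left] at k1 k2 k3 k4 k5 k6 k7
  norm_num at k1 k2 k3 k4 k5 k6 k7
  funext i
  fin_cases i <;> simp <;> linarith

/-- **Load-bearing (c).** Any proof of the crux must use the pressure growth bound: without it the
strain modes refute the statement at `u = 0`. -/
theorem linearLiouvilleSeven_false_without_pressure_bound :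
    ¬ LinearLiouvilleSevenWithoutPressureBound := by
  intro h
  obtain ⟨c, hc, hdep⟩ := h 0 0 (inClassA_zero le_rfl) strainFamilyV strainFamilyQ strainFamily_clause
  exact hc (strainFamily_indep_modSlice c hdep)

end Strain


end Summit.NavierStokesRegularity.NavierStokesRegularity.Theorems.LinearLiouvilleSeven.Negative

end
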